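import Mathlib.Analysis.InnerProductSpace.Completion
import Mathlib.Analysis.InnerProductSpace.Positive
import Mathlib.Analysis.Normed.Module.Completion
import Mathlib.Analysis.Normed.Operator.Extend
import Literature.Probability.LatticeModels.TransferOperator
import Literature.MathematicalPhysics.QuantumLattice.OSContractionSemigroup
import HarnessLib

/-!
# Osterwalder–Schrader reconstruction of transfer data from a reflection-positive measure

The **lattice (unit-time-step) Osterwalder–Schrader reconstruction theorem**, Glimm–Jaffe,
*Quantum Physics* (2nd ed. 1987), §6.1, Prop. 6.1.1 and Thm. 6.1.3 (with the Remark "Transfer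
matrix of statistical physics"), Osterwalder–Seiler, Ann. Phys. 110 (1978) §2, Seiler, LNP 159
(1982) Ch. 2, Fröhlich–Israel–Lieb–Simon, CMP 62 (1978) §2–3: it CONSTRUCTS an instance of the
tree's hypothesis structure `Literature.Probability.LatticeModels.IsOSRealisation`
(`TransferOperator.lean`: Hilbert space, OS map `ι`, positive contraction `T`, vacuum `Ω`) from a
probability measure `μ` on a measurable space `Ω`, a time reflection `reflect`, a unit time shift
`shift` and a positive-time σ-algebra `m₊`, under the premises bundled in the `Prop`-valued
structure `IsOSReconstructible μ reflect shift m₊`: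

* **reflection positivity** of the OS form `b(F, G) = ∫ conj (F ∘ reflect) · G dμ` on bounded
  `m₊`-measurable observables (GJ (6.1.8), OS3), and its hermitian symmetry
  `conj b(G, F) = b(F, G)` (which is reflection invariance of `μ`, GJ Thm. 6.1.3 "reflection
  invariance");
* the shift preserves `m₊`-measurability and is **symmetric** for `b`:
  `b(F, G ∘ shift) = b(F ∘ shift, G)` (time-translation invariance of `μ` together with
  `reflect ∘ shift ∘ reflect = shift⁻¹`, GJ Thm. 6.1.3 (ii));
* **positivity of the shift**, `0 ≤ Re b(F, F ∘ shift)`: on the lattice this is reflection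
  positivity with respect to the hyperplane half a lattice unit above the reflection plane of
  `reflect` (FILS 1978 §3: site AND bond reflections; in the continuum it is automatic from
  `T(t) = T(t/2)²`). It is exactly what makes the unit transfer operator POSITIVE, as demanded by
  `TransferData` (whose mass gap is read off `T ≥ 0`).

## The construction (`IsOSReconstructible.*`, dot notation on the premise `h`)

* `h.PreSpace` — the bounded `m₊`-measurable observables `ℰ₊` (a type synonym of the submodule
  `boundedMeasurable m₊`), equipped with `b` as a `PreInnerProductSpace.Core` (positive semidefinite
  by RP = GJ Prop. 6.1.1; no quotient is taken: Mathlib's inner product spaces over a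
  `SeminormedAddCommGroup` allow null vectors);
* `h.Space := UniformSpace.Completion h.PreSpace` — **the OS Hilbert space `ℋ`** (the completion of
  a seminormed space identifies null vectors, so this is the completion of `ℰ₊/𝒩`, GJ (6.1.12));
* `h.vec`, `h.osMap` — the canonical map `^ : ℰ₊ → ℋ` (`osMap` is defined on all of `Ω → ℂ`, with
  junk value `0` off `ℰ₊`, as `IsOSRealisation` wants);
* `h.preShift` (`F ↦ F ∘ shift` on `ℰ₊`), the OS iteration
  `‖S F‖² = Re b(F, S² F) ≤ ‖F‖ ‖S² F‖` against the uniform bound `‖Sⁿ F‖² ≤ C_F² μ(Ω)`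
  (`norm_preShift_le`, GJ Thm. 6.1.3 (iii), through the tree's real-sequence lemma
  `Literature.MathematicalPhysics.QuantumLattice.le_of_sq_le_mul_succ`), and the **transfer
  operator** `h.transfer : ℋ →L[ℂ] ℋ`, the extension by continuity (`LinearMap.extendOfNorm`):
  a contraction, symmetric, positive, fixing the **vacuum** `h.vacuum = 1^`;
* `h.transferData : TransferData h.Space` and the theorem **`h.isOSRealisation`**:
  `IsOSRealisation μ reflect shift m₊ h.osMap h.transferData`; `h.exists_isOSRealisation`.

## What is NOT here

The verification of the premises for concrete lattice measures (site/bond reflection positivity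
of nearest-neighbour ferromagnets, FILS 1978) lives with the models
(`IsingAxisOSRealisation.lean` and its companions). No generator `H = -log T` (no unbounded
spectral calculus in Mathlib; `T` is the complete substitute, as in `TransferOperator.lean`).
Uniqueness of the realisation up to unitary equivalence (GNS uniqueness) is not formalised.

## References

* J. Glimm, A. Jaffe, *Quantum Physics: a functional integral point of view*, 2nd ed. (Springer
  1987), §6.1, Prop. 6.1.1, Thm. 6.1.3 and Remark (pp. 90–92). [GlimmJaffe1987]
* K. Osterwalder, E. Seiler, *Gauge field theories on a lattice*, Ann. Phys. 110 (1978) 440–471,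
  §2. [OsterwalderSeiler1978]
* J. Fröhlich, R. Israel, E. H. Lieb, B. Simon, *Phase transitions and reflection positivity. I*,
  Comm. Math. Phys. 62 (1978) 1–34, §2–3. [FILS1978]
* E. Seiler, *Gauge theories as a problem of constructive quantum field theory and statistical
  mechanics*, LNP 159 (Springer 1982), Ch. 2.

Mathlib: `PreInnerProductSpace.Core`, `InnerProductSpace.ofCore`, `UniformSpace.Completion`
(`Completion.inner_coe`, `denseRange_coe`, `induction_on`), `LinearMap.extendOfNorm`,
`ContinuousLinearMap.IsPositive`. Tree: `TransferData`, `IsOSRealisation`, `IsBoundedMeasurable`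
(`TransferOperator.lean`), `le_of_sq_le_mul_succ` (`QuantumLattice/OSContractionSemigroup.lean`).
-/

noncomputable section

open MeasureTheory
open scoped InnerProductSpace ComplexConjugate

namespace Literature.Probability.LatticeModels

variable {Ω : Type*} {mΩ : MeasurableSpace Ω}

/-! ### The OS form and the premises -/

/-- The **Osterwalder–Schrader sesquilinear form** of a measure `μ` and a time reflection
`reflect`: `b(F, G) = ∫ conj (F (reflect ω)) · G ω dμ` (Glimm–Jaffe 1987, (6.1.11):
`b(A, B) = ⟨θA, B⟩_{L²}`; this is the right-hand side of `IsOSRealisation.inner_eq`).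
[cite: GlimmJaffe1987, §6.1 eq. (6.1.11)] -/
def osForm (μ : Measure Ω) (reflect : Ω → Ω) (F G : Ω → ℂ) : ℂ :=
  ∫ ω, conj (F (reflect ω)) * G ω ∂μ

/-- Unfolding `osForm`. [folklore] -/
theorem osForm_def (μ : Measure Ω) (reflect : Ω → Ω) (F G : Ω → ℂ) :
    osForm μ reflect F G = ∫ ω, conj (F (reflect ω)) * G ω ∂μ := rfl

/-- The bounded `m₊`-measurable complex observables (`IsBoundedMeasurable m₊`, Glimm–Jaffe's
`ℰ₊` of §6.1 in bounded-measurable form) as a `ℂ`-submodule of all observables. [cite: GlimmJaffe1987, §6.1 (the algebra ℰ₊)] -/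
def boundedMeasurable (mpos : MeasurableSpace Ω) : Submodule ℂ (Ω → ℂ) where
  carrier := {F | IsBoundedMeasurable mpos F}
  add_mem' := by
    rintro F G ⟨hFm, CF, hCF⟩ ⟨hGm, CG, hCG⟩
    exact ⟨hFm.add hGm, CF + CG, fun ω => (norm_add_le _ _).trans (add_le_add (hCF ω) (hCG ω))⟩
  zero_mem' := ⟨measurable_const, 0, fun ω => by simp⟩
  smul_mem' := by
    rintro c F ⟨hFm, CF, hCF⟩
    refine ⟨hFm.const_smul c, ‖c‖ * CF, fun ω => ?_⟩
    rw [Pi.smul_apply, smul_eq_mul, norm_mul]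
    exact mul_le_mul_of_nonneg_left (hCF ω) (norm_nonneg c)

/-- Membership in `boundedMeasurable m₊` is `IsBoundedMeasurable m₊`. [folklore] -/
@[simp] theorem mem_boundedMeasurable {mpos : MeasurableSpace Ω} {F : Ω → ℂ} :
    F ∈ boundedMeasurable mpos ↔ IsBoundedMeasurable mpos F := Iff.rfl

/-- **Premises of the lattice Osterwalder–Schrader reconstruction** (Glimm–Jaffe 1987, Thm. 6.1.3:
"Assume reflection positivity (OS3) and reflection and time translation invariance"; lattice /
transfer-matrix form with a unit time step, Osterwalder–Seiler 1978 §2, FILS 1978 §2–3) for a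
measure `μ` on `Ω`, a time reflection `reflect`, a unit time shift `shift` and a positive-time
σ-algebra `m₊ ≤ mΩ`, all phrased through the OS form `b = osForm μ reflect` on bounded
`m₊`-measurable observables:
* `rp` — reflection positivity `0 ≤ Re b(F, F)` (OS3, GJ (6.1.8));
* `conj_symm` — hermitian symmetry `conj b(G, F) = b(F, G)` (reflection invariance of `μ`);
* `measurable_comp_shift` — the shift maps `ℰ₊` into itself (`T(t) : ℰ₊ → ℰ₊`, `t ≥ 0`);
* `shift_symm` — `b(F, G ∘ shift) = b(F ∘ shift, G)` (time-translation invariance of `μ` and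
  `θ T(t) θ = T(-t)`; GJ Thm. 6.1.3 (ii));
* `rp_shift` — `0 ≤ Re b(F, F ∘ shift)`: reflection positivity for the reflection plane moved by
  half a time step (FILS 1978 §3, reflections through sites AND through bonds), the lattice
  substitute for `T(t) = T(t/2)* T(t/2) ≥ 0`; it is what makes the unit transfer operator positive.
`le` and `measurable_reflect` make the integrands `conj (F ∘ reflect) · G` integrable.
[cite: GlimmJaffe1987, §6.1  Theorem 6.1.3] -/
structure IsOSReconstructible (μ : Measure Ω) (reflect shift : Ω → Ω) (mpos : MeasurableSpace Ω) :
    Prop where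
  /-- The positive-time σ-algebra is a sub-σ-algebra of the ambient one. -/
  le : mpos ≤ mΩ
  /-- The time reflection is measurable (for the ambient σ-algebra). -/
  measurable_reflect : Measurable[mΩ, mΩ] reflect
  /-- Reflection positivity (OS3): `0 ≤ Re b(F, F)` on bounded positive-time observables. -/
  rp : ∀ F, IsBoundedMeasurable mpos F → 0 ≤ (osForm μ reflect F F).re
  /-- Hermitian symmetry of the OS form (reflection invariance of `μ`). -/
  conj_symm : ∀ F G, IsBoundedMeasurable mpos F → IsBoundedMeasurable mpos G →
    conj (osForm μ reflect G F) = osForm μ reflect F G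
  /-- The time shift maps positive-time observables to positive-time observables. -/
  measurable_comp_shift : ∀ G : Ω → ℂ, Measurable[mpos] G → Measurable[mpos] (G ∘ shift)
  /-- The shift is symmetric for the OS form (time-translation invariance of `μ`). -/
  shift_symm : ∀ F G, IsBoundedMeasurable mpos F → IsBoundedMeasurable mpos G →
    osForm μ reflect F (G ∘ shift) = osForm μ reflect (F ∘ shift) G
  /-- Positivity of the shift for the OS form (reflection positivity half a step higher). -/
  rp_shift : ∀ F, IsBoundedMeasurable mpos F → 0 ≤ (osForm μ reflect F (F ∘ shift)).re

namespace IsOSReconstructible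

variable {μ : Measure Ω} {reflect shift : Ω → Ω} {mpos : MeasurableSpace Ω}

/-! ### Bounded measurable observables: closure properties and integrability -/

/-- `ℰ₊` is stable under the time shift (Glimm–Jaffe 1987 §6.1, `T(t) : ℰ₊ → ℰ₊`). [cite: GlimmJaffe1987, §6.1  Theorem 6.1.3] -/
theorem isBoundedMeasurable_comp_shift (h : IsOSReconstructible μ reflect shift mpos)
    {G : Ω → ℂ} (hG : IsBoundedMeasurable mpos G) : IsBoundedMeasurable mpos (G ∘ shift) := by
  obtain ⟨C, hC⟩ := hG.2
  exact ⟨h.measurable_comp_shift G hG.1, C, fun ω => hC _⟩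

/-- The OS integrand `conj (F ∘ reflect) · G` of two bounded positive-time observables is
integrable (bounded and measurable on a finite measure space). [folklore] -/
theorem integrable_osIntegrand [IsFiniteMeasure μ] (h : IsOSReconstructible μ reflect shift mpos)
    {F G : Ω → ℂ} (hF : IsBoundedMeasurable mpos F) (hG : IsBoundedMeasurable mpos G) :
    Integrable (fun ω => conj (F (reflect ω)) * G ω) μ := by
  obtain ⟨CF, hCF⟩ := hF.2
  obtain ⟨CG, hCG⟩ := hG.2
  have hFm : Measurable[mΩ] F := hF.1.mono h.le le_rfl
  have hGm : Measurable[mΩ] G := hG.1.mono h.le le_rfl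
  have hm : Measurable[mΩ] fun ω => conj (F (reflect ω)) * G ω :=
    ((Complex.continuous_conj.measurable.comp (hFm.comp h.measurable_reflect)).mul hGm)
  refine Integrable.of_bound hm.aestronglyMeasurable (CF * CG) (ae_of_all _ fun ω => ?_)
  rw [norm_mul, Complex.norm_conj]
  exact mul_le_mul (hCF (reflect ω)) (hCG ω) (norm_nonneg _) ((norm_nonneg _).trans (hCF (reflect ω)))

/-- The OS form is bounded by the sup norms: `‖b(F, G)‖ ≤ C_F C_G μ(Ω)`. [folklore] -/
theorem norm_osForm_le [IsFiniteMeasure μ] {F G : Ω → ℂ} {CF CG : ℝ}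
    (hCF : ∀ ω, ‖F ω‖ ≤ CF) (hCG : ∀ ω, ‖G ω‖ ≤ CG) :
    ‖osForm μ reflect F G‖ ≤ CF * CG * μ.real Set.univ := by
  refine norm_integral_le_of_norm_le_const (ae_of_all _ fun ω => ?_)
  rw [norm_mul, Complex.norm_conj]
  exact mul_le_mul (hCF (reflect ω)) (hCG ω) (norm_nonneg _) ((norm_nonneg _).trans (hCF (reflect ω)))

/-! ### The pre-Hilbert space `ℰ₊` with the OS form -/

/-- The **OS pre-Hilbert space** `ℰ₊`: the bounded positive-time observables, a type synonym of
`boundedMeasurable m₊` to be equipped with the OS form as a semi-inner product (Glimm–Jaffe 1987,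
§6.1, Prop. 6.1.1: `b` is a positive semidefinite form on `ℰ₊`). [cite: GlimmJaffe1987, §6.1 Prop. 6.1.1] -/
@[nolint unusedArguments]
def PreSpace (_h : IsOSReconstructible μ reflect shift mpos) : Type _ :=
  ↥(boundedMeasurable (Ω := Ω) mpos)

variable (h : IsOSReconstructible μ reflect shift mpos)

/-- The vector space structure of `ℰ₊` (group). [folklore] -/
instance instAddCommGroup : AddCommGroup h.PreSpace :=
  inferInstanceAs (AddCommGroup ↥(boundedMeasurable (Ω := Ω) mpos))

/-- The vector space structure of `ℰ₊` (`ℂ`-module). [folklore] -/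
instance instModule : Module ℂ h.PreSpace :=
  inferInstanceAs (Module ℂ ↥(boundedMeasurable (Ω := Ω) mpos))

/-- A bounded positive-time observable as an element of `ℰ₊`. [folklore] -/
def toPre {F : Ω → ℂ} (hF : IsBoundedMeasurable mpos F) : h.PreSpace := ⟨F, hF⟩

/-- The underlying observable of an element of `ℰ₊`. [folklore] -/
def fn (F : h.PreSpace) : Ω → ℂ := (F : ↥(boundedMeasurable (Ω := Ω) mpos)).1

/-- Elements of `ℰ₊` are bounded positive-time observables. [folklore] -/
theorem isBoundedMeasurable_fn (F : h.PreSpace) : IsBoundedMeasurable mpos (h.fn F) :=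
  (F : ↥(boundedMeasurable (Ω := Ω) mpos)).2

/-- `fn ∘ toPre = id`. [folklore] -/
@[simp] theorem fn_toPre {F : Ω → ℂ} (hF : IsBoundedMeasurable mpos F) : h.fn (h.toPre hF) = F := rfl

/-- `toPre ∘ fn = id`. [folklore] -/
@[simp] theorem toPre_fn (F : h.PreSpace) : h.toPre (h.isBoundedMeasurable_fn F) = F := rfl

/-- `fn` is additive. [folklore] -/
theorem fn_add (F G : h.PreSpace) : h.fn (F + G) = h.fn F + h.fn G := rfl

/-- `fn` is homogeneous. [folklore] -/
theorem fn_smul (c : ℂ) (F : h.PreSpace) : h.fn (c • F) = c • h.fn F := rfl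

/-- The time shift `S F = F ∘ shift` as a linear endomorphism of `ℰ₊` (`T(1) : ℰ₊ → ℰ₊`;
Glimm–Jaffe 1987, Thm. 6.1.3). [cite: GlimmJaffe1987, §6.1  Theorem 6.1.3] -/
def preShift : h.PreSpace →ₗ[ℂ] h.PreSpace where
  toFun F := h.toPre (h.isBoundedMeasurable_comp_shift (h.isBoundedMeasurable_fn F))
  map_add' _ _ := rfl
  map_smul' _ _ := rfl

/-- The underlying observable of `S F` is `F ∘ shift`. [folklore] -/
@[simp] theorem fn_preShift (F : h.PreSpace) : h.fn (h.preShift F) = h.fn F ∘ shift := rfl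

/-- The underlying observables along the shift orbit keep the sup-norm bound. [folklore] -/
theorem norm_fn_preShift_iterate_le (F : h.PreSpace) {C : ℝ} (hC : ∀ ω, ‖h.fn F ω‖ ≤ C) (n : ℕ)
    (ω : Ω) : ‖h.fn (h.preShift^[n] F) ω‖ ≤ C := by
  induction n generalizing ω with
  | zero => simpa using hC ω
  | succ n ih =>
    rw [Function.iterate_succ_apply', fn_preShift]
    exact ih _

/-- The constant observable `1 ∈ ℰ₊`. [folklore] -/
def preOne : h.PreSpace := h.toPre (isBoundedMeasurable_one mpos)

/-- The underlying observable of `preOne` is `1`. [folklore] -/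
@[simp] theorem fn_preOne : h.fn h.preOne = 1 := rfl

/-- The shift fixes `1`. [folklore] -/
theorem preShift_preOne : h.preShift h.preOne = h.preOne := rfl

variable [IsProbabilityMeasure μ]

/-- **The OS form as a `PreInnerProductSpace.Core` on `ℰ₊`**: hermitian by reflection invariance,
positive semidefinite by reflection positivity (Glimm–Jaffe 1987, Prop. 6.1.1). [cite: GlimmJaffe1987, §6.1 Prop. 6.1.1] -/
instance instCore : PreInnerProductSpace.Core ℂ h.PreSpace where
  inner F G := osForm μ reflect (h.fn F) (h.fn G)
  conj_inner_symm F G := h.conj_symm _ _ (h.isBoundedMeasurable_fn F) (h.isBoundedMeasurable_fn G)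
  re_inner_nonneg F := h.rp _ (h.isBoundedMeasurable_fn F)
  add_left F F' G := by
    change osForm μ reflect (h.fn (F + F')) (h.fn G) =
      osForm μ reflect (h.fn F) (h.fn G) + osForm μ reflect (h.fn F') (h.fn G)
    rw [fn_add, osForm, osForm, osForm, ← integral_add
      (h.integrable_osIntegrand (h.isBoundedMeasurable_fn F) (h.isBoundedMeasurable_fn G))
      (h.integrable_osIntegrand (h.isBoundedMeasurable_fn F') (h.isBoundedMeasurable_fn G))]
    refine integral_congr_ae (ae_of_all _ fun ω => ?_)
    simp only [Pi.add_apply, map_add, add_mul]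
  smul_left F G r := by
    change osForm μ reflect (h.fn (r • F)) (h.fn G) = conj r * osForm μ reflect (h.fn F) (h.fn G)
    rw [fn_smul, osForm, osForm, ← integral_const_mul]
    refine integral_congr_ae (ae_of_all _ fun ω => ?_)
    simp only [Pi.smul_apply, smul_eq_mul, map_mul, mul_assoc]

/-- The seminormed group structure `‖F‖ = √(Re b(F, F))` on `ℰ₊`. [folklore] -/
instance instSeminormedAddCommGroup : SeminormedAddCommGroup h.PreSpace :=
  @InnerProductSpace.Core.toSeminormedAddCommGroup ℂ _ _ _ _ h.instCore

/-- The pre-inner-product space structure on `ℰ₊`. [folklore] -/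
instance instInnerProductSpace : InnerProductSpace ℂ h.PreSpace :=
  InnerProductSpace.ofCore h.instCore

/-- The inner product of `ℰ₊` is the OS form. [cite: GlimmJaffe1987, §6.1 eq. (6.1.11)] -/
theorem inner_pre (F G : h.PreSpace) : ⟪F, G⟫_ℂ = osForm μ reflect (h.fn F) (h.fn G) := rfl

/-- `‖F‖² = Re b(F, F)` on `ℰ₊`. [folklore] -/
theorem norm_pre_sq (F : h.PreSpace) : ‖F‖ ^ 2 = (osForm μ reflect (h.fn F) (h.fn F)).re := by
  rw [← inner_self_eq_norm_sq (𝕜 := ℂ), inner_pre]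
  rfl

/-- Sup-norm bound of the seminorm: `‖F‖² ≤ C_F² μ(Ω) = C_F²`. [folklore] -/
theorem norm_pre_sq_le (F : h.PreSpace) {C : ℝ} (hC : ∀ ω, ‖h.fn F ω‖ ≤ C) : ‖F‖ ^ 2 ≤ C * C := by
  rw [norm_pre_sq]
  refine (Complex.re_le_norm _).trans ((norm_osForm_le hC hC).trans ?_)
  simp

/-! ### The OS Hilbert space and the canonical map -/

/-- **The OS Hilbert space `ℋ`**: the completion of `ℰ₊` (which identifies the null space `𝒩` of
`b`, so this is the completion of `ℰ₊/𝒩`; Glimm–Jaffe 1987, (6.1.12)). [cite: GlimmJaffe1987, §6.1 eq. (6.1.12)] -/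
abbrev Space : Type _ := UniformSpace.Completion h.PreSpace

/-- The canonical map `^ : ℰ₊ → ℋ` as a linear map (the coercion into the completion). [cite: GlimmJaffe1987, §6.1 eq. (6.1.12)] -/
def vec : h.PreSpace →ₗ[ℂ] h.Space :=
  (UniformSpace.Completion.toComplₗᵢ : h.PreSpace →ₗᵢ[ℂ] h.Space).toLinearMap

/-- `vec` is the coercion into the completion. [folklore] -/
theorem vec_apply (F : h.PreSpace) : h.vec F = ((F : h.PreSpace) : h.Space) := rfl

/-- `^` has dense range. [cite: GlimmJaffe1987, §6.1 Thm. 6.1.3] -/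
theorem denseRange_vec : DenseRange h.vec :=
  (UniformSpace.Completion.denseRange_coe : DenseRange ((↑) : h.PreSpace → h.Space))

/-- `⟪F^, G^⟫ = b(F, G)` (Glimm–Jaffe (6.1.12c)). [cite: GlimmJaffe1987, §6.1 eq. (6.1.12)] -/
@[simp] theorem inner_vec_vec (F G : h.PreSpace) :
    ⟪h.vec F, h.vec G⟫_ℂ = osForm μ reflect (h.fn F) (h.fn G) := by
  rw [vec_apply, vec_apply, UniformSpace.Completion.inner_coe, inner_pre]

/-- `‖F^‖ = ‖F‖`. [folklore] -/
@[simp] theorem norm_vec (F : h.PreSpace) : ‖h.vec F‖ = ‖F‖ := UniformSpace.Completion.norm_coe F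

open Classical in
/-- **The OS map `ι`** on all observables: `ι F = F^` for bounded positive-time `F`, and the junk
value `0` otherwise (only the values on `ℰ₊` matter for `IsOSRealisation`). [cite: GlimmJaffe1987, §6.1 eq. (6.1.12)] -/
def osMap (F : Ω → ℂ) : h.Space :=
  if hF : IsBoundedMeasurable mpos F then h.vec (h.toPre hF) else 0

/-- On `ℰ₊` the OS map is `^`. [folklore] -/
theorem osMap_eq {F : Ω → ℂ} (hF : IsBoundedMeasurable mpos F) : h.osMap F = h.vec (h.toPre hF) := by
  unfold osMap
  rw [dif_pos hF]

/-- `⟪ι F, ι G⟫ = ∫ conj (F ∘ reflect) · G dμ` on `ℰ₊` (Glimm–Jaffe (6.1.12c)). [cite: GlimmJaffe1987, §6.1 eq. (6.1.12)] -/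
theorem inner_osMap_osMap {F G : Ω → ℂ} (hF : IsBoundedMeasurable mpos F)
    (hG : IsBoundedMeasurable mpos G) :
    ⟪h.osMap F, h.osMap G⟫_ℂ = ∫ ω, conj (F (reflect ω)) * G ω ∂μ := by
  rw [osMap_eq h hF, osMap_eq h hG, inner_vec_vec]
  rfl

/-! ### The shift on `ℰ₊` and the OS contraction estimate -/

/-- **The shift is symmetric on `ℰ₊`**: `⟪S F, G⟫ = ⟪F, S G⟫` (Glimm–Jaffe Thm. 6.1.3 (ii)). [cite: GlimmJaffe1987, §6.1  Theorem 6.1.3] -/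
theorem inner_preShift_left (F G : h.PreSpace) : ⟪h.preShift F, G⟫_ℂ = ⟪F, h.preShift G⟫_ℂ := by
  rw [inner_pre, inner_pre, fn_preShift, fn_preShift]
  exact (h.shift_symm _ _ (h.isBoundedMeasurable_fn F) (h.isBoundedMeasurable_fn G)).symm

/-- Iterates of the shift are symmetric. [folklore] -/
theorem inner_preShift_iterate_left (n : ℕ) (F G : h.PreSpace) :
    ⟪h.preShift^[n] F, G⟫_ℂ = ⟪F, h.preShift^[n] G⟫_ℂ := by
  induction n generalizing F G with
  | zero => rfl
  | succ n ih =>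
    calc ⟪h.preShift^[n + 1] F, G⟫_ℂ = ⟪h.preShift (h.preShift^[n] F), G⟫_ℂ := by
          rw [Function.iterate_succ_apply']
      _ = ⟪F, h.preShift^[n] (h.preShift G)⟫_ℂ := by rw [inner_preShift_left, ih]
      _ = ⟪F, h.preShift^[n + 1] G⟫_ℂ := by rw [Function.iterate_succ_apply]

/-- **The OS iteration inequality** `‖Sⁿ F‖² = Re ⟪F, S²ⁿ F⟫ ≤ ‖F‖ ‖S²ⁿ F‖`
(Glimm–Jaffe Thm. 6.1.3 (iii); Osterwalder–Schrader (4.9)). [cite: GlimmJaffe1987, §6.1  Theorem 6.1.3] -/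
theorem norm_preShift_iterate_sq_le (n : ℕ) (F : h.PreSpace) :
    ‖h.preShift^[n] F‖ ^ 2 ≤ ‖F‖ * ‖h.preShift^[n + n] F‖ := by
  have h1 : (‖h.preShift^[n] F‖ ^ 2 : ℝ) = RCLike.re ⟪F, h.preShift^[n + n] F⟫_ℂ := by
    rw [← inner_self_eq_norm_sq (𝕜 := ℂ), inner_preShift_iterate_left, Function.iterate_add_apply]
  rw [h1]
  exact (RCLike.re_le_norm _).trans (norm_inner_le_norm _ _)

/-- **Contraction on the dense domain** (Glimm–Jaffe Thm. 6.1.3 (iii)): `‖F ∘ shift‖ ≤ ‖F‖` in the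
OS seminorm, by the doubly exponential iteration of `norm_preShift_iterate_sq_le` along
`n = 1, 2, 4, …` against the uniform bound `‖Sⁿ F‖ ≤ C_F` (`le_of_sq_le_mul_succ`). In particular
the shift preserves the null space of the OS form (GJ (6.1.14)). [cite: GlimmJaffe1987, §6.1  Theorem 6.1.3] -/
theorem norm_preShift_le (F : h.PreSpace) : ‖h.preShift F‖ ≤ ‖F‖ := by
  obtain ⟨C, hC⟩ := (h.isBoundedMeasurable_fn F).2
  let a : ℕ → ℝ := fun n => ‖h.preShift^[2 ^ n] F‖
  have ha0 : a 0 = ‖h.preShift F‖ := by simp [a]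
  rw [← ha0]
  refine Literature.MathematicalPhysics.QuantumLattice.le_of_sq_le_mul_succ (norm_nonneg F)
    (M := Real.sqrt (C * C)) (fun n => ?_) fun n => ?_
  · exact (Real.le_sqrt (norm_nonneg _) (mul_self_nonneg C)).2
      (h.norm_pre_sq_le _ (h.norm_fn_preShift_iterate_le F hC _))
  · have h2 : 2 ^ (n + 1) = 2 ^ n + 2 ^ n := by rw [pow_succ, mul_two]
    change ‖h.preShift^[2 ^ n] F‖ ^ 2 ≤ ‖F‖ * ‖h.preShift^[2 ^ (n + 1)] F‖
    rw [h2]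
    exact h.norm_preShift_iterate_sq_le (2 ^ n) F

/-! ### The transfer operator -/

/-- **The transfer operator `T` on `ℋ`** (Glimm–Jaffe Thm. 6.1.3, `T(1)^ = e^{-H}`; the transfer
matrix of the Remark following it): the extension by continuity (`LinearMap.extendOfNorm`) of
`F^ ↦ (F ∘ shift)^`, well defined and contractive by `norm_preShift_le`. [cite: GlimmJaffe1987, §6.1  Theorem 6.1.3] -/
def transfer : h.Space →L[ℂ] h.Space := (h.vec ∘ₗ h.preShift).extendOfNorm h.vec

/-- `T F^ = (F ∘ shift)^` (Glimm–Jaffe (6.1.12a)). [cite: GlimmJaffe1987, §6.1 eq. (6.1.12)] -/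
@[simp] theorem transfer_vec (F : h.PreSpace) : h.transfer (h.vec F) = h.vec (h.preShift F) :=
  LinearMap.extendOfNorm_eq h.denseRange_vec ⟨1, fun G => by
    simpa using h.norm_preShift_le G⟩ F

/-- `T` is a contraction: `‖T ψ‖ ≤ ‖ψ‖` (Glimm–Jaffe Thm. 6.1.3 (iii)). [cite: GlimmJaffe1987, §6.1  Theorem 6.1.3] -/
theorem norm_transfer_apply_le (ψ : h.Space) : ‖h.transfer ψ‖ ≤ ‖ψ‖ := by
  have h1 : ‖h.transfer ψ‖ ≤ 1 * ‖ψ‖ :=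
    LinearMap.norm_extendOfNorm_apply_le h.denseRange_vec 1 (fun G => by
      simpa using h.norm_preShift_le G) ψ
  simpa using h1

/-- `‖T‖ ≤ 1`. [cite: GlimmJaffe1987, §6.1  Theorem 6.1.3] -/
theorem opNorm_transfer_le : ‖h.transfer‖ ≤ 1 :=
  ContinuousLinearMap.opNorm_le_bound _ zero_le_one fun ψ => by simpa using h.norm_transfer_apply_le ψ

/-- **`T` is symmetric**: `⟪T φ, ψ⟫ = ⟪φ, T ψ⟫` (Glimm–Jaffe Thm. 6.1.3 (ii)). [cite: GlimmJaffe1987, §6.1  Theorem 6.1.3] -/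
theorem inner_transfer_left (φ ψ : h.Space) : ⟪h.transfer φ, ψ⟫_ℂ = ⟪φ, h.transfer ψ⟫_ℂ := by
  refine h.denseRange_vec.induction_on φ ?_ fun F => ?_
  · exact isClosed_eq ((h.transfer).continuous.inner continuous_const) (continuous_id.inner continuous_const)
  · refine h.denseRange_vec.induction_on ψ ?_ fun G => ?_
    · exact isClosed_eq (continuous_const.inner continuous_id) (continuous_const.inner (h.transfer).continuous)
    · rw [transfer_vec, transfer_vec, vec_apply, vec_apply, vec_apply, vec_apply,
        UniformSpace.Completion.inner_coe, UniformSpace.Completion.inner_coe, inner_preShift_left]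

/-- **`T` is positive on the dense domain**: `Re ⟪T F^, F^⟫ = Re b(F ∘ shift, F) = Re b(F, F ∘ shift) ≥ 0`
(the premise `rp_shift`; Glimm–Jaffe 1987 §6.1, Remark "Transfer matrix of statistical physics":
`0 ≤ K ≤ I`). [cite: GlimmJaffe1987, §6.1 Remark (Transfer matrix of statistical physics)] -/
theorem re_inner_transfer_vec_self_nonneg (F : h.PreSpace) : 0 ≤ (⟪h.transfer (h.vec F), h.vec F⟫_ℂ).re := by
  rw [transfer_vec, inner_vec_vec, fn_preShift,
    ← h.conj_symm _ _ (h.isBoundedMeasurable_comp_shift (h.isBoundedMeasurable_fn F)) (h.isBoundedMeasurable_fn F),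
    Complex.conj_re]
  exact h.rp_shift _ (h.isBoundedMeasurable_fn F)

/-- `0 ≤ Re ⟪T ψ, ψ⟫` on `ℋ` (by density; Glimm–Jaffe 1987 §6.1 Remark, `0 ≤ K`). [cite: GlimmJaffe1987, §6.1 Remark (Transfer matrix of statistical physics)] -/
theorem re_inner_transfer_self_nonneg (ψ : h.Space) : 0 ≤ (⟪h.transfer ψ, ψ⟫_ℂ).re := by
  refine h.denseRange_vec.induction_on ψ ?_ fun F => h.re_inner_transfer_vec_self_nonneg F
  exact isClosed_le continuous_const (Complex.continuous_re.comp ((h.transfer).continuous.inner continuous_id))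

/-- **`T ≥ 0`** as a bounded operator (Mathlib's `ContinuousLinearMap.IsPositive`: symmetric with
`0 ≤ Re ⟪T ψ, ψ⟫`). [cite: GlimmJaffe1987, §6.1  Theorem 6.1.3] -/
theorem isPositive_transfer : h.transfer.IsPositive :=
  ⟨fun φ ψ => h.inner_transfer_left φ ψ, fun ψ => h.re_inner_transfer_self_nonneg ψ⟩

/-! ### The vacuum and the transfer data -/

/-- **The vacuum `Ω = 1^`** (Glimm–Jaffe Thm. 6.1.3). [cite: GlimmJaffe1987, §6.1  Theorem 6.1.3] -/
def vacuum : h.Space := h.vec h.preOne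

/-- `T Ω = Ω` (Glimm–Jaffe Thm. 6.1.3, `H Ω = 0`). [cite: GlimmJaffe1987, §6.1  Theorem 6.1.3] -/
theorem transfer_vacuum : h.transfer h.vacuum = h.vacuum := by
  rw [vacuum, transfer_vec, preShift_preOne]

/-- `‖Ω‖ = 1` for a probability measure: `‖1^‖² = b(1, 1) = μ(Ω) = 1`. [folklore] -/
theorem norm_vacuum : ‖h.vacuum‖ = 1 := by
  have h2 : ‖h.vacuum‖ ^ 2 = 1 := by
    rw [vacuum, norm_vec, norm_pre_sq, fn_preOne, osForm]
    simp
  exact (pow_eq_one_iff_of_nonneg (norm_nonneg _) two_ne_zero).1 h2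

/-- **The reconstructed transfer data** `(T, Ω)` on the OS Hilbert space (Glimm–Jaffe Thm. 6.1.3
and the transfer-matrix Remark). [cite: GlimmJaffe1987, §6.1  Theorem 6.1.3] -/
def transferData : TransferData h.Space where
  T := h.transfer
  vacuum := h.vacuum
  isPositive := h.isPositive_transfer
  norm_le_one := h.opNorm_transfer_le
  map_vacuum := h.transfer_vacuum
  norm_vacuum := h.norm_vacuum

/-- The transfer operator of the reconstructed data. [folklore] -/
@[simp] theorem transferData_T : h.transferData.T = h.transfer := rfl

/-- The vacuum of the reconstructed data. [folklore] -/
@[simp] theorem transferData_vacuum : h.transferData.vacuum = h.vacuum := rfl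

/-! ### The reconstruction theorem -/

/-- `ι (G ∘ shift) = T (ι G)` on `ℰ₊` (Glimm–Jaffe (6.1.12a)). [cite: GlimmJaffe1987, §6.1 eq. (6.1.12)] -/
theorem osMap_comp_shift {G : Ω → ℂ} (hG : IsBoundedMeasurable mpos G) :
    h.osMap (G ∘ shift) = h.transfer (h.osMap G) := by
  rw [osMap_eq h (h.isBoundedMeasurable_comp_shift hG), osMap_eq h hG, transfer_vec]
  rfl

/-- `ι 1 = Ω`. [cite: GlimmJaffe1987, §6.1  Theorem 6.1.3] -/
theorem osMap_one : h.osMap 1 = h.vacuum := by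
  rw [osMap_eq h (isBoundedMeasurable_one mpos)]
  rfl

/-- The image of `ℰ₊` under `ι` is dense in `ℋ`. [cite: GlimmJaffe1987, §6.1  Theorem 6.1.3] -/
theorem dense_image_osMap : Dense (h.osMap '' {G | IsBoundedMeasurable mpos G}) := by
  refine h.denseRange_vec.mono ?_
  rintro _ ⟨F, rfl⟩
  exact ⟨h.fn F, h.isBoundedMeasurable_fn F, osMap_eq h (h.isBoundedMeasurable_fn F)⟩

/-- **Osterwalder–Schrader reconstruction (lattice form of Glimm–Jaffe 1987, Thm. 6.1.3).** Under
the premises `IsOSReconstructible μ reflect shift m₊` for a probability measure `μ`, the completion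
`ℋ` of the bounded positive-time observables for the OS form, the map `ι = osMap` and the transfer
data `(T, Ω) = transferData` REALISE the OS reconstruction of `μ` in the sense of
`IsOSRealisation`: `⟪ι F, ι G⟫ = ∫ conj (F ∘ reflect) · G dμ`, `ι (G ∘ shift) = T (ι G)` with `T` a
positive contraction, `ι 1 = Ω` a unit vector fixed by `T`, dense range. [cite: GlimmJaffe1987, §6.1  Theorem 6.1.3] -/
theorem isOSRealisation : IsOSRealisation μ reflect shift mpos h.osMap h.transferData where
  inner_eq _ _ hF hG := h.inner_osMap_osMap hF hG
  measurable_comp_shift := h.measurable_comp_shift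
  map_shift _ hG := h.osMap_comp_shift hG
  map_one := h.osMap_one
  dense := h.dense_image_osMap

/-- **Existence form** of the reconstruction theorem: a Hilbert space (namely `h.Space`), an OS map
and transfer data realising `μ`. [cite: GlimmJaffe1987, §6.1  Theorem 6.1.3] -/
theorem exists_isOSRealisation :
    ∃ (ι : (Ω → ℂ) → h.Space) (D : TransferData h.Space), IsOSRealisation μ reflect shift mpos ι D :=
  ⟨h.osMap, h.transferData, h.isOSRealisation⟩

/-- Matrix elements of powers of `T` are shifted OS pairings:
`⟪ι F, Tⁿ ι G⟫ = ∫ conj (F ∘ reflect) · (G ∘ shiftⁿ) dμ` (Glimm–Jaffe (6.1.12d)). [cite: GlimmJaffe1987, §6.1  Theorem 6.1.3] -/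
theorem inner_osMap_transfer_pow_osMap {F G : Ω → ℂ} (hF : IsBoundedMeasurable mpos F)
    (hG : IsBoundedMeasurable mpos G) (n : ℕ) :
    ⟪h.osMap F, (h.transfer ^ n) (h.osMap G)⟫_ℂ = ∫ ω, conj (F (reflect ω)) * G (shift^[n] ω) ∂μ :=
  (h.isOSRealisation.integral_conj_comp_reflect_mul_comp_iterate hF hG n).symm

end IsOSReconstructible

end Literature.Probability.LatticeModels
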